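import Summits.BirchSwinnertonDyer.BirchSwinnertonDyer.Theorems.GenusKolyvaginAtTwoPowDvdShaCardAtTwoRTKolyvaginMinima
import Summits.BirchSwinnertonDyer.BirchSwinnertonDyer.Theorems.GenusKolyvaginAtTwoRegularKolyvaginSupplyAtTwo
import Summits.BirchSwinnertonDyer.BirchSwinnertonDyer.Theorems.GenusKolyvaginAtTwoShaCardDvdPowAtTwoPosTSharpExponentRatOfRegularPairSupplyCorollaries
import HarnessLib

/-!
# Route `GenusKolyvaginAtTwo`, crux L⁺_T `PowDvdShaCardAtTwoPosT` (stmt-BirchSwinnertonDyer-23379), road (E4)⁺, KS⁺ ASSEMBLY, FIRST OF TWO FILES —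
# TRANSPOSITION-DEEP ZHANG–KOLYVAGIN PRIMES BEYOND EVERY FINITE SET (from the PROVED regular supply) and square-free products in the class
# (§1, §3 = the minima themselves in `…PosTKolyvaginMinimaTransposition`)

Seat `bsd-line-gk2-p2` g22 (PROVER seat 2/3, cell `bsd-f1-sign2`), `--supports stmt-BirchSwinnertonDyer-23379` (helper; closes nothing).
THEOREMS ONLY (no definition, no named fact, no `sorry`; the minima are produced inside the proof by `sSup`).  BSD is NOT proved by any of this; neither
is L⁺_T, nor KS⁺.

WHY (LEAD R10/R10′; memo `Cruxes/KolyvaginExactAtTwoPosDiscT/RESTATEMENT-R9L-posdisc-lower-gk2p2.md`).  Road (E4)⁺ for L⁺_T = the sign-free capstone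
(p741898) fed by X-ORTH⁺ (this seat: `…PosTTranspositionFrame`, `…PosTCrossTermTransposition`, `…PosTCrossPairProvenanceTransposition`,
`…PosTXOrthTransposition`), `rank E(K) ≤ 1` (free on the cut) and KS⁺ = the KS integrator `kolyvaginSuppliesAtTwo_of_deepSwap_pred` (gk2-p2 g20) run over
the class of Zhang–Kolyvagin primes of index `≥ L + k` whose Frobenius MOVES A POINT OF `E[2]` (transposition type) instead of Gross's class.  The
integrator's only sign-dependent input is the minima `RelaxedCount.exists_kolyvaginMinima_pred` (its record clause `exists_recordLevel_avoiding_of_deepSwap`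
is sign-free and `G`-generic as landed), and the minima touch `Δ < 0` only through TWO Čebotarev calls: the deep signed pair Čebotarev
(`infinite_kolyvaginPrime_localization_fullOrder_pair_deep`, antitone step) and the empty-family Q5R (square-free products exist).  This file:
* §0 `exists_transpositionDeep_notMem_finset` — transposition-deep Zhang–Kolyvagin primes of any index beyond every finite set, from the PROVED regular
  supply `regularKolyvaginSupplyAtTwo_proof` (empty family) — replaces the empty-family Q5R;
* §1 `exists_datum_mul_pow_zsmul_kolyvaginClass_ne_zero_transposition` — the antitone step with the deep pair Čebotarev DISPLAYED as a socket `hCheb` in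
  transposition currency (to be discharged by gk2-p5 g32's `…PosTTranspositionPairChebotarev`, = gk2-p4 g23's Part C shifted to level `2^(L+k)`);
* §2 `exists_squarefree_card_primeFactors_transposition`; §3 **`exists_kolyvaginMinima_transposition`** — the minima over the transposition-deep class,
  same six conclusions as `exists_kolyvaginMinima_pred`, NO sign of `Δ`, NO `d_K·(−|Δ|)` non-square.
Transposition clause (level-free; this seat's currency, = LEAD R9-FINAL's witness clause): `∃ v 𝔓 (h : Γ_ℚ), ℓ ∈ v ∧ 𝔓 ∈ v.primesAbove ∧
IsArithFrobAt (𝓞 ℚ) h 𝔓 ∧ ∃ u : E[2], h • u ≠ u`.  Next file (this seat): `kolyvaginSuppliesAtTwo_of_deepSwap_transposition` (the KS⁺ integrator over the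
sockets hbot⁺ / hswap⁺ (gk2-p5) / hK⁺ (gk2-p4)) and the (E4)⁺ closer skeleton.

References: [McCallumLMS1991] §5 p. 285, Prop. 5.2, §3 Cor. 3.2, §4 Cor. 4.5; [GrossLMS1991] §3 (3.1)–(3.3), §4 (4.1), Prop. 6.2; [Kolyvagin1991StructureSha].
-/

set_option autoImplicit false
-- the Theorems namespace of this sub repeats the summit name by design (D-0017 nested layout)
set_option linter.dupNamespace false

noncomputable section

open scoped Classical

open Field NumberField IsDedekindDomain WeierstrassCurve Rat.HeightOneSpectrum
open Literature.NumberTheory.EllipticCurves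
open Literature.NumberTheory.GaloisRepresentations
open Summit.BirchSwinnertonDyer.BirchSwinnertonDyer.Theses.GenusKolyvaginAtTwo (KolyvaginRelationAtTwo)
open Summit.BirchSwinnertonDyer.Rank1Residual (X11b.KolyvaginAssembly.discr_lt_neg_four JET.exists_compatible_data_of_grossCM)
open Summit.BirchSwinnertonDyer.BirchSwinnertonDyer.Theorems.GenusExact.VisiblePairAtTwo
  (natCast_mem_primesEquiv_symm natCast_prime_mem_iff_eq exists_natCast_mem)

namespace Summit.BirchSwinnertonDyer.BirchSwinnertonDyer.Theorems.GenusExact.RelaxedCount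

variable {K : Type} [Field K] [NumberField K]

/-! ## §0 Transposition-deep primes beyond every finite set (the regular supply, empty family) -/

/-- **Transposition-deep Zhang–Kolyvagin primes beyond every finite set** (the empty-family case of the PROVED regular Čebotarev supply
`GenusRegularSupply.regularKolyvaginSupplyAtTwo_proof`, p664271): `E/ℚ` globally minimal with `ρ_{E,2^m}` onto for all `m`, `K` imaginary quadratic with
`d_K` odd and the Heegner hypothesis, `c ≠ 1`, `M ≥ 1`: for every finite `X` there is `ℓ ∉ X`, Zhang–Kolyvagin at `2` of index `≥ M`, whose
Frobenius moves a point of `E[2]`.  (Index from `2^M ∣ ℓ+1`, `2^M ∣ a_ℓ` by `Zhang2014.le_kolyvaginIndex_iff`; the moved `2`-torsion point from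
the supply's regularity witness by gk2-p5 g31's `exists_smul_ne_twoTorsion_of_regular_witness`.) [cite: GrossLMS1991, §3 (3.1)–(3.3)]
[cite: McCallumLMS1991, §3 Cor. 3.2] -/
theorem exists_transpositionDeep_notMem_finset (W : WeierstrassCurve ℚ) [W.IsElliptic] [W.IsGloballyMinimal] [NeZero (W.conductorNorm ℤ)]
    (hK : IsImaginaryQuadratic K) (hodd : Odd (NumberField.discr K)) (hHe : SatisfiesHeegnerHypothesis (W.conductorNorm ℤ) K)
    (hρ : ∀ m : ℕ, W.HasSurjectiveModNGaloisRep (2 ^ m : ℕ)) (c : K ≃ₐ[ℚ] K) (hc : c ≠ 1) {M : ℕ} (hM : 1 ≤ M) (X : Finset ℕ) :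
    ∃ ℓ : ℕ, ℓ ∉ X ∧ Zhang2014.IsKolyvaginPrime (W.conductorNorm ℤ) W K 2 ℓ ∧ M ≤ Zhang2014.kolyvaginIndex W 2 ℓ ∧
      (∃ (v : HeightOneSpectrum (𝓞 ℚ)) (𝔓 : Ideal (absIntegers (𝓞 ℚ) ℚ)) (h : absoluteGaloisGroup ℚ),
        (ℓ : 𝓞 ℚ) ∈ v.asIdeal ∧ 𝔓 ∈ v.primesAbove ∧ IsArithFrobAt (𝓞 ℚ) h 𝔓 ∧ ∃ u : geomTorsion W 2, h • u ≠ u) := by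
  haveI : Fact (Nat.Prime 2) := ⟨Nat.prime_two⟩
  obtain ⟨n, rfl⟩ : ∃ n, M = n + 1 := ⟨M - 1, by omega⟩
  obtain ⟨c₀, hc₀⟩ := exists_isComplexConjugation (Rat.castHom ℝ)
  have hρ' : ∀ m : ℕ, 0 < m → W.HasSurjectiveModNGaloisRep ((2 : ℤ) ^ m) := fun m _ ↦ by exact_mod_cast hρ m
  obtain ⟨ρ, -, -, hreg, -, ℓ, hbℓ, hℓp, hℓN, hℓD, hℓ2, hprime, ⟨v, 𝔓, h, hv, h𝔓, hfr, hhP, -⟩, hdvd1, hdvd2, -⟩ :=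
    GenusRegularSupply.regularKolyvaginSupplyAtTwo_proof W K hK hodd hHe hρ' n c₀ hc₀ c hc 0 ![] ![] (fun i ↦ i.elim0) (fun i ↦ i.elim0)
      ![] (fun i ↦ i.elim0) (fun a _ i ↦ i.elim0) (fun a _ ↦ by simp) ![] (fun i ↦ i.elim0) (fun i ↦ i.elim0)
      (fun i ↦ i.elim0) (X.sup id)
  have hidx : n + 1 ≤ Zhang2014.kolyvaginIndex W 2 ℓ :=
    (Zhang2014.le_kolyvaginIndex_iff (W := W) (p := 2)).mpr ⟨hdvd1, by exact_mod_cast hdvd2⟩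
  refine ⟨ℓ, fun hX ↦ ?_, ⟨hℓp, hℓN, hℓD, hℓ2, hprime, lt_of_lt_of_le (Nat.succ_pos n) hidx⟩, hidx, v, 𝔓, h, hv, h𝔓, hfr, ?_⟩
  · exact absurd (Finset.le_sup (f := id) hX) (not_le.mpr hbℓ)
  · exact PlusDescent.exists_smul_ne_two_of_natCast W (PlusDescent.exists_smul_ne_twoTorsion_of_regular_witness W hhP hreg)

/-! ## §2 Square-free products in the transposition-deep class -/

/-- **`r`-fold square-free products of Zhang–Kolyvagin primes of index `≥ L` satisfying `G` exist**, for every predicate `G` implied by «index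
`≥ L + k` and TRANSPOSITION type», given any supply of such primes avoiding every finite set (`hSup`; e.g. `exists_transpositionDeep_notMem_finset`).
(Sign-free twin of `exists_squarefree_card_primeFactors_kolyvagin_margin`; induct on `r`.) [cite: McCallumLMS1991, §3 Cor. 3.2] [cite: GrossLMS1991, §3 (3.1)–(3.3)] -/
theorem exists_squarefree_card_primeFactors_transposition (W : WeierstrassCurve ℚ) [W.IsElliptic] [W.IsGloballyMinimal]
    [NeZero (W.conductorNorm ℤ)] {L k : ℕ}
    (hSup : ∀ X : Finset ℕ, ∃ q : ℕ, q ∉ X ∧ Zhang2014.IsKolyvaginPrime (W.conductorNorm ℤ) W K 2 q ∧ L + k ≤ Zhang2014.kolyvaginIndex W 2 q ∧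
      (∃ (v : HeightOneSpectrum (𝓞 ℚ)) (𝔓 : Ideal (absIntegers (𝓞 ℚ) ℚ)) (h : absoluteGaloisGroup ℚ),
        (q : 𝓞 ℚ) ∈ v.asIdeal ∧ 𝔓 ∈ v.primesAbove ∧ IsArithFrobAt (𝓞 ℚ) h 𝔓 ∧ ∃ u : geomTorsion W 2, h • u ≠ u))
    (G : ℕ → Prop)
    (hG : ∀ q : ℕ, Zhang2014.IsKolyvaginPrime (W.conductorNorm ℤ) W K 2 q → L + k ≤ Zhang2014.kolyvaginIndex W 2 q →
      (∃ (v : HeightOneSpectrum (𝓞 ℚ)) (𝔓 : Ideal (absIntegers (𝓞 ℚ) ℚ)) (h : absoluteGaloisGroup ℚ),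
        (q : 𝓞 ℚ) ∈ v.asIdeal ∧ 𝔓 ∈ v.primesAbove ∧ IsArithFrobAt (𝓞 ℚ) h 𝔓 ∧ ∃ u : geomTorsion W 2, h • u ≠ u) → G q) (r : ℕ) :
    ∃ n : ℕ, Squarefree n ∧ n.primeFactors.card = r ∧
      ∀ q ∈ n.primeFactors, (Zhang2014.IsKolyvaginPrime (W.conductorNorm ℤ) W K 2 q ∧ L ≤ Zhang2014.kolyvaginIndex W 2 q) ∧ G q := by
  induction r with
  | zero => exact ⟨1, squarefree_one, by simp, by simp⟩
  | succ r ih =>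
    obtain ⟨n, hn, hcard, hnK⟩ := ih
    have hn0 : n ≠ 0 := hn.ne_zero
    obtain ⟨ℓ, hℓn, hKol, hidx, hFr⟩ := hSup n.primeFactors
    have hℓp : ℓ.Prime := hKol.1
    have hℓdvd : ¬ ℓ ∣ n := fun h ↦ hℓn (Nat.mem_primeFactors.mpr ⟨hℓp, h, hn0⟩)
    refine ⟨n * ℓ, (Nat.squarefree_mul ((Nat.Prime.coprime_iff_not_dvd hℓp).mpr hℓdvd).symm).mpr ⟨hn, hℓp.squarefree⟩, ?_, ?_⟩
    · rw [Nat.primeFactors_mul hn0 hℓp.ne_zero, hℓp.primeFactors, Finset.card_union_of_disjoint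
        (Finset.disjoint_singleton_right.mpr hℓn), hcard, Finset.card_singleton]
    · intro q hq
      rw [Nat.primeFactors_mul hn0 hℓp.ne_zero, Finset.mem_union] at hq
      rcases hq with hq | hq
      · exact hnK q hq
      · rw [hℓp.primeFactors, Finset.mem_singleton] at hq
        subst hq
        exact ⟨⟨hKol, le_trans (Nat.le_add_right L k) hidx⟩, hG q hKol hidx hFr⟩

end Summit.BirchSwinnertonDyer.BirchSwinnertonDyer.Theorems.GenusExact.RelaxedCount

end
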